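import Literature.MathematicalPhysics.QuantumLattice.HeisenbergOrderNeelDiagonalSumRule
import HarnessLib

/-!
# Window Gram forms of the ground-state two-point function (Heisenberg antiferromagnet, any torus)

Literature: Dyson–Lieb–Simon, *J. Stat. Phys.* **18** (1978) 335, Theorem 4.2 (reflection
positivity of the antiferromagnet) [cite: DLS1978, Theorem 4.2]; Kennedy–Lieb–Shastry,
*J. Stat. Phys.* **53** (1988) 1019, p. 1021 (the two-point function `g_q ≥ 0`) and eqs. (20)–(25)
(Gaussian domination / reflection positivity at `T = 0`) [cite: KLS1988JSP, eqs. (20)–(25)].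

Two positive-semidefiniteness statements about the translation-reduced ground-state correlation
function `c(r) = G(0, r) = Re ω(Sᶻ_0 Sᶻ_r)` of the spin-`n/2` antiferromagnet on the torus, written
as **window inequalities valid on every torus at once** — the form in which a linear programme
whose unknowns are finitely many values `c(a, b)` can use them with the side `L = 2k` SYMBOLIC:

* (B) **positivity (Bochner)**: `0 ≤ Σ_{x,y} u_x u_y G(x, y)` for every real `u` (`heis_transGram_nonneg`,
  any dimension): `G(x,y) = c(y - x) = L^{-d} Σ_q ĝ_q cos(p_q·(y - x))` with `ĝ_q ≥ 0`
  (`heisStructureFactor_nonneg`) and `cos(p·(y-x)) = cos cos + sin sin`; as a window inequality on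
  the square torus, for ANY `m, w` and any real table `v` (no condition on `L`: sites are taken
  mod `L` and coincident sites only aggregate the vector),
  `0 ≤ Σ_{i,i'<m} Σ_{t,t'<w} v_{it} v_{i't'} c(|i - i'|, |t - t'|)` (`heis_transGramWindow_range`);
* (R) **reflection positivity**: the real-space Gram form `heis_rpGramZ_nonneg` of
  `HeisenbergRPCorrelationBlocks.lean` compressed to a window of `m ≤ k` rows next to the
  reflection plane and ANY number `w` of transverse sites:
  `0 ≤ Σ_{i,i'<m} Σ_{t,t'<w} v_{it} v_{i't'} (−c(i + i' + 1, |t - t'|))` on the torus of side `2k`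
  (`heis_rpGramWindow_range`).

Both are stated in the natural-number API `c(a, b) = heisRedCorr2 L n a b` with the distances
`|t - t'| = Int.natAbs (t - t')`, so that a certificate row instantiates `v` by a rational table,
expands `Finset.sum_range_succ`, and `norm_num` closes the indices while `L` (or `k`) stays a
variable.  The folding lemmas `c(a, -b) = c(a, b)`, `c(-a, b) = c(a, b)` (axis reflections,
`heisGroundCorr_torusReflect`) and `G(0, (a, t - t')) = c(a, |t - t'|)` are recorded on the way.

Everything is proved; no named facts.  (Written for the pub-hubbard certificate ladder — ladder
R1–R4 with certified numbers; no claim on H/H₀: together with the dictionary infrared bound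
`kls_heis_kernelCorr_lower_energyFree` these are the `L`-uniform linear cuts of the dictionary
infrared linear programmes on the finite-volume Néel correlations.)
-/

noncomputable section

open Finset Literature.Probability.LatticeModels

namespace Literature.MathematicalPhysics.QuantumLattice

variable {d : ℕ}

/-! ### (B) Positivity of the translation-invariant kernel `G(x, y) = c(y - x)` -/

/-- **Bochner positivity of the two-point function**: for every real `u` on the torus,
`0 ≤ Σ_{x,y} u_x u_y G(x, y)` — since `L^d G(x,y) = Σ_q ĝ_q cos(p_q·(y-x))`, `ĝ_q ≥ 0`, and
`Σ_{x,y} u_x u_y cos(p·(y-x)) = (Σ u cos)² + (Σ u sin)²`. [cite: KLS1988JSP, p. 1021] -/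
theorem heis_transGram_nonneg (L : ℕ) [NeZero L] (n : ℕ) (u : TorusSite d L → ℝ) :
    0 ≤ ∑ x : TorusSite d L, ∑ y : TorusSite d L, u x * u y * heisGroundCorr 0 L n x y := by
  have hL : (0 : ℝ) < (L : ℝ) ^ d := by
    have : (0 : ℝ) < L := by exact_mod_cast Nat.pos_of_ne_zero (NeZero.ne L)
    positivity
  have hinv : ∀ x y : TorusSite d L, (L : ℝ) ^ d * heisGroundCorr 0 L n x y =
      ∑ q : TorusSite d L, heisStructureFactor 0 L n q * Real.cos (torusPhase L q (y - x)) := by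
    intro x y
    rw [heisGroundCorr_eq_zero_left 0 L n x y, sum_heisStructureFactor_mul_cos_torusPhase,
      sum_heisGroundCorr_shift]
  have key : (L : ℝ) ^ d * ∑ x : TorusSite d L, ∑ y : TorusSite d L, u x * u y * heisGroundCorr 0 L n x y =
      ∑ q : TorusSite d L, heisStructureFactor 0 L n q *
        ((∑ x : TorusSite d L, u x * Real.cos (torusPhase L q x)) ^ 2 +
          (∑ x : TorusSite d L, u x * Real.sin (torusPhase L q x)) ^ 2) := by
    have h1 : (L : ℝ) ^ d * ∑ x : TorusSite d L, ∑ y : TorusSite d L, u x * u y * heisGroundCorr 0 L n x y =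
        ∑ x : TorusSite d L, ∑ y : TorusSite d L, ∑ q : TorusSite d L,
          u x * u y * (heisStructureFactor 0 L n q * Real.cos (torusPhase L q (y - x))) := by
      rw [mul_sum]
      refine sum_congr rfl fun x _ => ?_
      rw [mul_sum]
      refine sum_congr rfl fun y _ => ?_
      rw [← mul_sum, ← hinv]
      ring
    have h2 : ∀ q : TorusSite d L, heisStructureFactor 0 L n q *
        ((∑ x : TorusSite d L, u x * Real.cos (torusPhase L q x)) ^ 2 +
          (∑ x : TorusSite d L, u x * Real.sin (torusPhase L q x)) ^ 2) =
        ∑ x : TorusSite d L, ∑ y : TorusSite d L,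
          u x * u y * (heisStructureFactor 0 L n q * Real.cos (torusPhase L q (y - x))) := by
      intro q
      rw [sq, sq, sum_mul_sum, sum_mul_sum, ← sum_add_distrib, mul_sum]
      refine sum_congr rfl fun x _ => ?_
      rw [← sum_add_distrib, mul_sum]
      refine sum_congr rfl fun y _ => ?_
      rw [cos_torusPhase_sub]
      ring
    rw [h1]
    refine ((sum_congr rfl fun x _ => sum_comm).trans sum_comm).trans ?_
    exact sum_congr rfl fun q _ => (h2 q).symm
  have hnn : 0 ≤ (L : ℝ) ^ d * ∑ x : TorusSite d L, ∑ y : TorusSite d L, u x * u y * heisGroundCorr 0 L n x y := by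
    rw [key]
    exact sum_nonneg fun q _ => mul_nonneg (heisStructureFactor_nonneg L n q) (by positivity)
  exact (mul_nonneg_iff_of_pos_left hL).mp hnn

/-! ### Folding lemmas: axis reflections and natural-number distances -/

/-- Reflection of the second axis: `c(a, -b) = c(a, b)`. [cite: KLS1988JSP, p. 1021] -/
theorem heisGroundCorr_zero_vec2_neg_snd (L : ℕ) [NeZero L] (n : ℕ) (a b : ZMod L) :
    heisGroundCorr 0 L n 0 ![a, -b] = heisGroundCorr 0 L n 0 ![a, b] := by
  have h := heisGroundCorr_torusReflect L n (1 : Fin 2) 0 (0 : TorusSite 2 L) ![a, b]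
  have h0 : torusReflect L (1 : Fin 2) (0 : TorusSite 2 L) = 0 := by
    ext j
    simp [torusReflect]
  have h1 : torusReflect L (1 : Fin 2) ![a, b] = ![a, -b] := by
    ext j
    fin_cases j <;> simp [torusReflect]
  rw [h0, h1] at h
  exact h

/-- Reflection of the first axis: `c(-a, b) = c(a, b)`. [cite: KLS1988JSP, p. 1021] -/
theorem heisGroundCorr_zero_vec2_neg_fst (L : ℕ) [NeZero L] (n : ℕ) (a b : ZMod L) :
    heisGroundCorr 0 L n 0 ![-a, b] = heisGroundCorr 0 L n 0 ![a, b] := by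
  have h := heisGroundCorr_torusReflect L n (0 : Fin 2) 0 (0 : TorusSite 2 L) ![a, b]
  have h0 : torusReflect L (0 : Fin 2) (0 : TorusSite 2 L) = 0 := by
    ext j
    simp [torusReflect]
  have h1 : torusReflect L (0 : Fin 2) ![a, b] = ![-a, b] := by
    ext j
    fin_cases j <;> simp [torusReflect]
  rw [h0, h1] at h
  exact h

/-- Natural-number distances in the second coordinate: `G(0, (a, t - t')) = c(a, |t - t'|)`.
[cite: KLS1988JSP, p. 1021] -/
theorem heisGroundCorr_zero_natCast_sub_snd (L : ℕ) [NeZero L] (n a t t' : ℕ) :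
    heisGroundCorr 0 L n 0 ![(a : ZMod L), (t : ZMod L) - (t' : ZMod L)] =
      heisRedCorr2 L n a (Int.natAbs ((t : ℤ) - t')) := by
  rcases le_total t' t with h | h
  · have e1 : (t : ZMod L) - (t' : ZMod L) = ((t - t' : ℕ) : ZMod L) := by rw [Nat.cast_sub h]
    have e2 : Int.natAbs ((t : ℤ) - t') = t - t' := by omega
    rw [e1, e2, heisRedCorr2]
  · have e1 : (t : ZMod L) - (t' : ZMod L) = -((t' - t : ℕ) : ZMod L) := by
      rw [Nat.cast_sub h]; ring
    have e2 : Int.natAbs ((t : ℤ) - t') = t' - t := by omega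
    rw [e1, e2, heisGroundCorr_zero_vec2_neg_snd, heisRedCorr2]

/-- Natural-number distances in both coordinates: `G(0, (i - i', t - t')) = c(|i - i'|, |t - t'|)`.
[cite: KLS1988JSP, p. 1021] -/
theorem heisGroundCorr_zero_natCast_sub_sub (L : ℕ) [NeZero L] (n i i' t t' : ℕ) :
    heisGroundCorr 0 L n 0 ![(i : ZMod L) - (i' : ZMod L), (t : ZMod L) - (t' : ZMod L)] =
      heisRedCorr2 L n (Int.natAbs ((i : ℤ) - i')) (Int.natAbs ((t : ℤ) - t')) := by
  rcases le_total i' i with h | h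
  · have e1 : (i : ZMod L) - (i' : ZMod L) = ((i - i' : ℕ) : ZMod L) := by rw [Nat.cast_sub h]
    have e2 : Int.natAbs ((i : ℤ) - i') = i - i' := by omega
    rw [e1, e2, heisGroundCorr_zero_natCast_sub_snd]
  · have e1 : (i : ZMod L) - (i' : ZMod L) = -((i' - i : ℕ) : ZMod L) := by
      rw [Nat.cast_sub h]; ring
    have e2 : Int.natAbs ((i : ℤ) - i') = i' - i := by omega
    rw [e1, e2, heisGroundCorr_zero_vec2_neg_fst, heisGroundCorr_zero_natCast_sub_snd]

/-! ### Compression of a Gram form to a finite combination of point masses -/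

/-- A linear combination of point masses against a function: `Σ_x (Σ_p [x = s_p] v_p) F(x) = Σ_p v_p F(s_p)`.
[folklore] -/
private theorem sum_comb_mul {X ι : Type*} [Fintype X] [DecidableEq X] (S : Finset ι) (s : ι → X)
    (v : ι → ℝ) (F : X → ℝ) :
    ∑ x : X, (∑ p ∈ S, if x = s p then v p else 0) * F x = ∑ p ∈ S, v p * F (s p) := by
  simp_rw [sum_mul, ite_mul, zero_mul]
  rw [sum_comm]
  refine sum_congr rfl fun p _ => ?_
  rw [sum_ite_eq' univ (s p)]
  simp

/-- **Compression**: a Gram form `Σ_{a,b} u_a u_b M(a,b)` at the vector `u = Σ_p v_p δ_{s_p}` is the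
finite double sum `Σ_{p,p'} v_p v_{p'} M(s_p, s_{p'})` (coincident `s_p` aggregate). [folklore] -/
private theorem gram_comb_eq {X ι : Type*} [Fintype X] [DecidableEq X] (M : X → X → ℝ) (S : Finset ι)
    (s : ι → X) (v : ι → ℝ) :
    ∑ a : X, ∑ b : X, (∑ p ∈ S, if a = s p then v p else 0) * (∑ p ∈ S, if b = s p then v p else 0) * M a b =
      ∑ p ∈ S, ∑ p' ∈ S, v p * v p' * M (s p) (s p') := by
  have h1 : ∀ a : X, ∑ b : X, (∑ p ∈ S, if a = s p then v p else 0) *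
      (∑ p ∈ S, if b = s p then v p else 0) * M a b =
      (∑ p ∈ S, if a = s p then v p else 0) * ∑ p' ∈ S, v p' * M a (s p') := by
    intro a
    rw [← sum_comb_mul S s v (M a), mul_sum]
    exact sum_congr rfl fun b _ => by ring
  simp_rw [h1]
  rw [sum_comb_mul S s v (fun a => ∑ p' ∈ S, v p' * M a (s p'))]
  refine sum_congr rfl fun p _ => ?_
  rw [mul_sum]
  exact sum_congr rfl fun p' _ => by ring

/-- Positivity transfer: if the Gram form of `M` is nonnegative at every real vector, then so is every
compressed form. [folklore] -/
private theorem gram_comb_nonneg {X ι : Type*} [Fintype X] [DecidableEq X] (M : X → X → ℝ)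
    (hM : ∀ u : X → ℝ, 0 ≤ ∑ a : X, ∑ b : X, u a * u b * M a b) (S : Finset ι) (s : ι → X) (v : ι → ℝ) :
    0 ≤ ∑ p ∈ S, ∑ p' ∈ S, v p * v p' * M (s p) (s p') := by
  rw [← gram_comb_eq]
  exact hM _

/-! ### (B) as a window inequality -/

/-- **Positivity window cut**, every torus: for all `m, w` and every real table `v`,
`0 ≤ Σ_{i<m} Σ_{t<w} Σ_{i'<m} Σ_{t'<w} v_{it} v_{i't'} c(|i-i'|, |t-t'|)`. [cite: KLS1988JSP, p. 1021] -/
theorem heis_transGramWindow_range (L : ℕ) [NeZero L] (n m w : ℕ) (v : ℕ → ℕ → ℝ) :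
    0 ≤ ∑ i ∈ range m, ∑ t ∈ range w, ∑ i' ∈ range m, ∑ t' ∈ range w,
      v i t * v i' t' * heisRedCorr2 L n (Int.natAbs ((i : ℤ) - i')) (Int.natAbs ((t : ℤ) - t')) := by
  have h := gram_comb_nonneg (fun x y : TorusSite 2 L => heisGroundCorr 0 L n x y)
    (heis_transGram_nonneg L n) (range m ×ˢ range w)
    (fun p => (![(p.1 : ZMod L), (p.2 : ZMod L)] : TorusSite 2 L)) (fun p => v p.1 p.2)
  rw [sum_product] at h
  refine h.trans_eq (sum_congr rfl fun i _ => sum_congr rfl fun t _ => ?_)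
  rw [sum_product]
  refine sum_congr rfl fun i' _ => sum_congr rfl fun t' _ => ?_
  dsimp only
  rw [heisGroundCorr_eq_zero_left 0 L n, show (![(i' : ZMod L), (t' : ZMod L)] : TorusSite 2 L) -
      ![(i : ZMod L), (t : ZMod L)] = ![(i' : ZMod L) - (i : ZMod L), (t' : ZMod L) - (t : ZMod L)] from by
        ext j; fin_cases j <;> simp,
    heisGroundCorr_zero_natCast_sub_sub, show Int.natAbs ((i' : ℤ) - i) = Int.natAbs ((i : ℤ) - i') from by
      rw [← neg_sub, Int.natAbs_neg], show Int.natAbs ((t' : ℤ) - t) = Int.natAbs ((t : ℤ) - t') from by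
      rw [← neg_sub, Int.natAbs_neg]]

/-! ### (R) Reflection positivity as a window inequality -/

/-- **Reflection-positivity window cut**, every even torus: on the torus of side `2k`, for `m ≤ k`
rows next to the reflection plane, ANY `w`, and every real table `v`,
`0 ≤ Σ_{i<m} Σ_{t<w} Σ_{i'<m} Σ_{t'<w} v_{it} v_{i't'} (−c(i+i'+1, |t-t'|))` — the Gram matrix
`[−ω(Sᶻ_x Sᶻ_{θy})]` of DLS Theorem 4.2 / KLS eq. (25) compressed to the window.
[cite: DLS1978, Theorem 4.2] [cite: KLS1988JSP, eq. (25)] -/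
theorem heis_rpGramWindow_range (k : ℕ) [NeZero (2 * k)] (n m w : ℕ) (hm : m ≤ k) (v : ℕ → ℕ → ℝ) :
    0 ≤ ∑ i ∈ range m, ∑ t ∈ range w, ∑ i' ∈ range m, ∑ t' ∈ range w,
      v i t * v i' t' * -heisRedCorr2 (2 * k) n (i + i' + 1) (Int.natAbs ((t : ℤ) - t')) := by
  have hk : 0 < k := Nat.pos_of_ne_zero fun h => NeZero.ne (2 * k) (by simp [h])
  -- the window sites as elements of the left half `Fin k × ZMod (2k)` (rows reduced mod `k`, harmless
  -- for rows `< m ≤ k`)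
  let s : ℕ × ℕ → Fin k × ZMod (2 * k) := fun p => (⟨p.1 % k, Nat.mod_lt _ hk⟩, (p.2 : ZMod (2 * k)))
  have h := gram_comb_nonneg _ (heis_rpGramZ_nonneg k n) (range m ×ˢ range w) s (fun p => v p.1 p.2)
  -- unfold the (private) displacement of `heis_rpGramZ_nonneg` by definitional unfolding
  have h' : 0 ≤ ∑ p ∈ range m ×ˢ range w, ∑ p' ∈ range m ×ˢ range w, v p.1 p.2 * v p'.1 p'.2 *
      -heisGroundCorr 0 (2 * k) n 0 ![(((s p).1 : ℕ) : ZMod (2 * k)) + (((s p').1 : ℕ) : ZMod (2 * k)) + 1,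
        (s p).2 - (s p').2] := h
  rw [sum_product] at h'
  refine h'.trans_eq (sum_congr rfl fun i hi => sum_congr rfl fun t _ => ?_)
  rw [sum_product]
  refine sum_congr rfl fun i' hi' => sum_congr rfl fun t' _ => ?_
  have hi1 : i % k = i := Nat.mod_eq_of_lt (lt_of_lt_of_le (mem_range.mp hi) hm)
  have hi2 : i' % k = i' := Nat.mod_eq_of_lt (lt_of_lt_of_le (mem_range.mp hi') hm)
  simp only [s, hi1, hi2]
  rw [show ((i : ℕ) : ZMod (2 * k)) + ((i' : ℕ) : ZMod (2 * k)) + 1 = ((i + i' + 1 : ℕ) : ZMod (2 * k)) from by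
      push_cast; ring, heisGroundCorr_zero_natCast_sub_snd]

end Literature.MathematicalPhysics.QuantumLattice

end
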